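import Mathlib.Analysis.Normed.Unbundled.SpectralNorm
import Mathlib.FieldTheory.Galois.Infinite
import Literature.FieldTheory.Kummer.KummerEigenDescent
import HarnessLib

/-!
# `ℓ`-th roots of elements close to `1` over a complete non-archimedean field lie in the field
# (a Krasner-type lemma, spectral-norm form)

Topic `NumberTheory/GaloisRepresentations`; namespace `Literature.NumberTheory.GaloisRepresentations`.
Theorems only: **no definition and no named fact is introduced** (D-0026).

Let `K` be a field complete for a non-trivial non-archimedean absolute value, `L/K` an algebraic
closure (more generally: `L` algebraically closed, algebraic and Galois over `K`), `|·|` the spectral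
norm of `L/K` (Mathlib `spectralNorm`, `spectralMulAlgNorm`: the unique absolute value of `L`
extending that of `K`), and `ℓ` a prime with `ℓ ≠ 0` in `K`.  For ANY intermediate field
`K ⊆ E ⊆ L` and `y ∈ E`:

> if `|y - 1| < |ℓ| ^ ℓ` then `y = z ^ ℓ` for some `z ∈ E`

(`exists_mem_pow_eq_of_spectralNorm_sub_one_lt`).  Thus the `ℓ`-th powers of `Eˣ` contain a
neighbourhood of `1` — the openness of `(Eˣ)^ℓ` used in every local Kummer-theoretic argument
(e.g. Cohen–Stevenhagen, *Computational class field theory*, §5: "`γ_𝔭ⁿ ≡ 1 mod 𝔭` … there is a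
unique element `γ_𝔭 ≡ 1 mod 𝔭`"; Neukirch, *Algebraic Number Theory*, Ch. II (4.6), Hensel's
lemma; Serre, *Local Fields*, Ch. XIV §4 for `p`-th powers of units).  The usual proof is
Hensel's lemma in the (complete) valuation ring of `E`; the proof here needs neither completeness
of `E` nor a valuation ring, only Galois theory in `L` and the root of unity estimate
`|1 - ζ| ≥ |ℓ|` (`spectralNorm_natCast_le_spectralNorm_one_sub`, from `ℓ = ∑_{j<ℓ} (1 - ζ^j)`):
writing `1 - y = ∏_{i<ℓ} (1 - ζ^i z₀)` for one root `z₀` (Mathlib `X_pow_sub_C_eq_prod`), some root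
`z = ζ^{i₀} z₀` has `|z - 1| < |ℓ|`; it is then the ONLY root in that ball (two roots differ by a
factor `ζ^j ≠ 1`, and `|ζ^j z - 1| = |ζ^j - 1| ≥ |ℓ|` by the ultrametric equality case), so it is
fixed by `Gal(L/E)`, which acts by isometries (`spectralNorm_eq_of_equiv`) and permutes the roots;
hence `z ∈ L^{Gal(L/E)} = E` (Mathlib `InfiniteGalois.fixedField_fixingSubgroup`).  This is the
argument of Krasner's lemma (Neukirch, *Algebraic Number Theory*, Ch. II §6, Exercise 2; Lang,
*Algebraic Number Theory*, II §2 Prop. 3) specialised to binomials.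

* `spectralNorm_pow_primitiveRoot` — `|ζ ^ i| = 1`;
* `spectralNorm_natCast_le_spectralNorm_one_sub` — `|ℓ| ≤ |1 - ζ|` for a primitive `ℓ`-th root
  of unity `ζ`;
* `exists_mem_pow_eq_of_spectralNorm_sub_one_lt` — the statement displayed above;
* `exists_pos_forall_exists_mem_pow_eq` — `∃ δ > 0, |y - 1| < δ → y ∈ (E)^ℓ`.

Written for the programme "CFT-free Clozel–Harris–Taylor Lemma 4.1.2"
(`NumberFields/SolubleCMExtensionPrescribedLocal.lean`): local conditions on a Kummer layer
`k(ζ)(A^{1/ℓ})` are imposed by approximating prescribed local classes modulo `ℓ`-th powers.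

## References

* J. Neukirch, *Algebraic Number Theory*, Grundlehren 322 (1999), Ch. II §6, Exercise 2 (Krasner's
  lemma), Ch. II (4.6) (Hensel's lemma), Ch. V §1 (`U^{(n)} ⊆ Kˣᵐ`). [NeukirchANT1999]
* J.-P. Serre, *Local Fields*, GTM 67 (1979), Ch. II §3 (uniqueness of the extended absolute
  value; Galois acts by isometries). [SerreLocalFields1979]
* H. Cohen, P. Stevenhagen, *Computational class field theory*, in Buhler–Stevenhagen (eds.),
  MSRI Publ. 44 (2008), §5. [BuhlerStevenhagen2008]
-/

noncomputable section

namespace Literature.NumberTheory.GaloisRepresentations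

open Polynomial IntermediateField Finset

universe u v

variable {K : Type u} [NontriviallyNormedField K] [CompleteSpace K] [IsUltrametricDist K]
  {L : Type v} [Field L] [Algebra K L] [Algebra.IsAlgebraic K L] {ℓ : ℕ}

/-- A root of unity has spectral norm `1`. [folklore] -/
theorem spectralNorm_pow_primitiveRoot (hℓ : 0 < ℓ) {ζ : L} (hζ : IsPrimitiveRoot ζ ℓ) (i : ℕ) :
    spectralNorm K L (ζ ^ i) = 1 := by
  set N := spectralMulAlgNorm K L with hNdef
  have hN : ∀ x, N x = spectralNorm K L x := fun x => rfl
  rw [← hN]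
  have h1 : N (ζ ^ i) ^ ℓ = 1 := by
    rw [← map_pow, ← pow_mul, mul_comm, pow_mul, hζ.pow_eq_one, one_pow, map_one]
  exact (pow_eq_one_iff_of_nonneg (apply_nonneg N _) hℓ.ne').mp h1

/-- **`|ℓ| ≤ |1 - ζ|`** for a primitive `ℓ`-th root of unity `ζ` (`ℓ` prime): `ℓ = ∑_{j<ℓ} (1 - ζ^j)`
(since `∑_{j<ℓ} ζ^j = 0`) and `1 - ζ^j = (1 - ζ)(1 + ζ + ⋯ + ζ^{j-1})` has second factor of norm
`≤ 1`.  Ref: Washington, *Introduction to Cyclotomic Fields*, Lemma 1.4 (`(1 - ζ)^{ℓ-1} ~ ℓ`). [folklore] -/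
theorem spectralNorm_natCast_le_spectralNorm_one_sub (hℓ : ℓ.Prime) {ζ : L}
    (hζ : IsPrimitiveRoot ζ ℓ) : spectralNorm K L (ℓ : L) ≤ spectralNorm K L (1 - ζ) := by
  set N := spectralMulAlgNorm K L with hNdef
  have hN : ∀ x, N x = spectralNorm K L x := fun x => rfl
  have hna : IsNonarchimedean N := isNonarchimedean_spectralNorm
  rw [← hN, ← hN]
  -- `ℓ = (∑_j ∑_{i<j} ζ^i) * (1 - ζ)`
  have hsum : (ℓ : L) = (∑ j ∈ range ℓ, ∑ i ∈ range j, ζ ^ i) * (1 - ζ) := by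
    rw [Finset.sum_mul]
    simp_rw [geom_sum_mul_neg]
    rw [Finset.sum_sub_distrib, hζ.geom_sum_eq_zero hℓ.one_lt, sub_zero]
    simp
  have hle : N (∑ j ∈ range ℓ, ∑ i ∈ range j, ζ ^ i) ≤ 1 := by
    refine Finset.sum_induction _ (fun x => N x ≤ 1) (fun a b ha hb => ?_) (by simp) ?_
    · exact (hna a b).trans (max_le ha hb)
    · intro j _
      refine Finset.sum_induction _ (fun x => N x ≤ 1) (fun a b ha hb => ?_) (by simp) ?_
      · exact (hna a b).trans (max_le ha hb)
      · intro i _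
        rw [hN, spectralNorm_pow_primitiveRoot hℓ.pos hζ]
  calc N (ℓ : L) = N (∑ j ∈ range ℓ, ∑ i ∈ range j, ζ ^ i) * N (1 - ζ) := by
        rw [hsum, map_mul]
    _ ≤ 1 * N (1 - ζ) := by gcongr
    _ = N (1 - ζ) := one_mul _

/-- **`ℓ`-th roots of elements close to `1` lie in the field.**  Let `L` be algebraically closed,
algebraic and Galois over the complete non-archimedean field `K`, `ℓ` a prime with `ℓ ≠ 0` in `L`,
`E` any intermediate field of `L/K` and `y ∈ E` with `|y - 1| < |ℓ| ^ ℓ` (spectral norm).  Then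
`y = z ^ ℓ` for some `z ∈ E`.  (Krasner's argument for the binomial `X^ℓ - y`: the root `z` closest
to `1` has `|z - 1| < |ℓ|`, is alone in that ball, hence fixed by `Gal(L/E)`.)
Ref: Neukirch, *Algebraic Number Theory*, Ch. II §6 Exercise 2 (Krasner) and Ch. V §1; Serre,
*Local Fields*, Ch. II §3. [cite: NeukirchANT1999, Ch. II §6 Exercise 2 (Krasner's lemma)] -/
theorem exists_mem_pow_eq_of_spectralNorm_sub_one_lt [IsAlgClosed L] [IsGalois K L]
    (hℓ : ℓ.Prime) (hℓ0 : (ℓ : L) ≠ 0) (E : IntermediateField K L) {y : L} (hy : y ∈ E)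
    (h : spectralNorm K L (y - 1) < spectralNorm K L (ℓ : L) ^ ℓ) : ∃ z ∈ E, z ^ ℓ = y := by
  classical
  set N := spectralMulAlgNorm K L with hNdef
  have hN : ∀ x, N x = spectralNorm K L x := fun x => rfl
  have hna : IsNonarchimedean N := isNonarchimedean_spectralNorm
  simp only [← hN] at h
  haveI : NeZero ℓ := ⟨hℓ.ne_zero⟩
  haveI : NeZero (ℓ : L) := ⟨hℓ0⟩
  -- trivial case `y = 0`
  by_cases hy0 : y = 0
  · exact ⟨0, zero_mem E, by rw [hy0, zero_pow hℓ.ne_zero]⟩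
  -- a primitive `ℓ`-th root of unity and one `ℓ`-th root of `y`
  obtain ⟨ζ, hζ⟩ : ∃ ζ : L, IsPrimitiveRoot ζ ℓ := by
    obtain ⟨ζ, hζ⟩ := IsAlgClosed.exists_root (cyclotomic ℓ L)
      (by rw [degree_cyclotomic]; exact_mod_cast (Nat.totient_pos.mpr hℓ.pos).ne')
    exact ⟨ζ, (isRoot_cyclotomic_iff).mp hζ⟩
  obtain ⟨z₀, hz₀⟩ := IsAlgClosed.exists_pow_nat_eq y hℓ.pos
  -- `1 - y = ∏_{i<ℓ} (1 - ζ^i z₀)`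
  have hprod : 1 - y = ∏ i ∈ range ℓ, (1 - ζ ^ i * z₀) := by
    have := congrArg (Polynomial.eval (1 : L)) (X_pow_sub_C_eq_prod hζ hℓ.pos hz₀)
    simpa [Polynomial.eval_prod] using this
  -- some root `z = ζ^{i₀} z₀` has `|1 - z| < |ℓ|`
  obtain ⟨i₀, -, hi₀⟩ : ∃ i₀ ∈ range ℓ, N (1 - ζ ^ i₀ * z₀) < N (ℓ : L) := by
    by_contra hcon
    simp only [not_exists, not_and, not_lt] at hcon
    have h1 : N (ℓ : L) ^ ℓ ≤ N (1 - y) := by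
      rw [hprod, map_prod, ← Finset.card_range ℓ, ← Finset.prod_const, Finset.card_range]
      exact Finset.prod_le_prod (fun i _ => apply_nonneg N _) hcon
    have h2 : N (1 - y) = N (y - 1) := by rw [← neg_sub, map_neg_eq_map]
    linarith
  set z : L := ζ ^ i₀ * z₀ with hzdef
  have hzpow : z ^ ℓ = y := by
    rw [hzdef, mul_pow, ← pow_mul, mul_comm i₀ ℓ, pow_mul, hζ.pow_eq_one, one_pow, one_mul, hz₀]
  have hz0 : z ≠ 0 := by
    rintro h
    rw [h, zero_pow hℓ.ne_zero] at hzpow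
    exact hy0 hzpow.symm
  have hz1 : N (z - 1) < N (ℓ : L) := by rwa [← neg_sub, map_neg_eq_map]
  refine ⟨z, ?_, hzpow⟩
  -- `z` is fixed by `Gal(L/E)`, hence lies in `E`
  rw [← InfiniteGalois.fixedField_fixingSubgroup E, IntermediateField.mem_fixedField_iff]
  intro σ hσ
  have hσy : σ y = y := (IntermediateField.mem_fixingSubgroup_iff E σ).mp hσ y hy
  have hσz : (σ z) ^ ℓ = z ^ ℓ := by rw [← map_pow, hzpow, hσy]
  obtain ⟨j, -, hj⟩ := Literature.FieldTheory.Kummer.exists_eq_pow_mul_of_pow_eq hζ hz0 hσz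
  by_cases hμ : ζ ^ j = 1
  · rw [hj, hμ, one_mul]
  · exfalso
    -- `μ = ζ ^ j` is a primitive `ℓ`-th root of unity, so `|ℓ| ≤ |μ - 1|`
    have hμroot : IsPrimitiveRoot (ζ ^ j) ℓ := by
      refine hζ.pow_of_coprime j (Nat.coprime_comm.mp ((Nat.Prime.coprime_iff_not_dvd hℓ).mpr ?_))
      exact fun hdvd => hμ ((hζ.pow_eq_one_iff_dvd j).mpr hdvd)
    have hμ1 : N (ℓ : L) ≤ N (ζ ^ j - 1) := by
      rw [← neg_sub, map_neg_eq_map]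
      exact spectralNorm_natCast_le_spectralNorm_one_sub hℓ hμroot
    -- `σ z - 1 = μ (z - 1) + (μ - 1)` has norm `|μ - 1| ≥ |ℓ|` …
    have hdecomp : σ z - 1 = ζ ^ j * (z - 1) + (ζ ^ j - 1) := by rw [hj]; ring
    have hsmall : N (ζ ^ j * (z - 1)) < N (ζ ^ j - 1) := by
      rw [map_mul, hN (ζ ^ j), spectralNorm_pow_primitiveRoot hℓ.pos hζ, one_mul]
      exact hz1.trans_le hμ1
    have hbig : N (σ z - 1) = N (ζ ^ j - 1) := by
      rw [hdecomp, IsNonarchimedean.add_eq_max_of_ne hna hsmall.ne, max_eq_right hsmall.le]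
    -- … but `σ` is an isometry: `|σ z - 1| = |z - 1| < |ℓ|`
    have hiso : N (σ z - 1) = N (z - 1) := by
      rw [show σ z - 1 = σ (z - 1) by rw [map_sub, map_one], hN, hN,
        ← spectralNorm_eq_of_equiv σ (z - 1)]
    have := hz1
    rw [← hiso, hbig] at this
    exact absurd (hμ1.trans_lt this) (lt_irrefl _)

/-- **The `ℓ`-th powers of `E` contain a neighbourhood of `1`** (for every intermediate field `E` of
`L/K` as above): there is `δ > 0` (namely `|ℓ| ^ ℓ`) such that every `y ∈ E` with `|y - 1| < δ` is
an `ℓ`-th power in `E`.  Ref: Neukirch, *Algebraic Number Theory*, Ch. V §1 (`U^{(n)} ⊆ Kˣᵐ` for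
`n` large); Serre, *Local Fields*, Ch. XIV §4. [cite: NeukirchANT1999, Ch. II §6 Exercise 2 (Krasner's lemma)] -/
theorem exists_pos_forall_exists_mem_pow_eq [IsAlgClosed L] [IsGalois K L] (hℓ : ℓ.Prime)
    (hℓ0 : (ℓ : L) ≠ 0) :
    ∃ δ : ℝ, 0 < δ ∧ ∀ (E : IntermediateField K L) (y : L), y ∈ E →
      spectralNorm K L (y - 1) < δ → ∃ z ∈ E, z ^ ℓ = y := by
  refine ⟨spectralNorm K L (ℓ : L) ^ ℓ, ?_, fun E y hy h =>
    exists_mem_pow_eq_of_spectralNorm_sub_one_lt hℓ hℓ0 E hy h⟩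
  have : 0 < spectralNorm K L (ℓ : L) := map_pos_of_ne_zero (spectralMulAlgNorm K L) hℓ0
  positivity

end Literature.NumberTheory.GaloisRepresentations

end
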